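import Summits.BirchSwinnertonDyer.BirchSwinnertonDyer.Theorems.ManinLocalTwoThreeTVClassIndepRows

/-!
# E-an-142, step (5.4) CLASS-INDEPENDENCE — assembly: `Ḡ` on `ℤ/q`, an's relation (★), LEMMA MH (cell bsd-f2-manin, an g30 PROOFS-an-72 §5.4;
# the one remaining stub `stub_classIndep` of TowerRigiditySkeleton-an-g30; work split with p1 g10)

Summit `BirchSwinnertonDyer`, route `ManinLocalTwoThree`, cruxes C3 `ManinPrimeToThreeAtNine` (stmt-BirchSwinnertonDyer-22968) / C2 `ManinOddAtFour`
(stmt-…-22967).  Continues `…TVClassIndepRows` (KEY and residue-mod-`q` dependence): at level `e+1`, `Ḡ(x̄) := g (e+1) x̄.val` is even, the deep row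
with `D = 1 + Nk(D̄.val − 1)ρ` turns the integer multi-hub equation into an's (★) `Ḡ h − Ḡ (hD) − Ḡ (h(1−D)D⁻¹) + Ḡ (h(1−D)) = 0`, and LEMMA MH
`MultiHubRigid q p` (tree theorem `multiHubRigid_holds`) makes `Ḡ` constant on `(ℤ/q)ˣ`; induction on the level from (P0).

* `tv_classIndep_succ` — the induction step; `tv_classIndep` — **(5.4)**: explicit binders = the `TVPatternRigidity` hypotheses used ((P0) (P1) (P2)
  (EV)), `hMH : TowerExtension.MultiHubRigid q p` BY NAME, the resolution `hres` (p1's `tv_resolution`), the integer multi-hub equation `hMHint`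
  (an's `fine_multiHub`, binders verbatim) ⊢ `∀ e r r′, IsCoprime r q → IsCoprime r′ q → g e r = g e r′`.

HONEST FRAMING: one step of the Lean proof of E-an-142; nothing about Manin's conjecture or BSD is proved here.
-/

set_option linter.dupNamespace false
set_option autoImplicit false

namespace Summit.BirchSwinnertonDyer.BirchSwinnertonDyer.Theorems.ManinLocalTwoThree

open Summit.BirchSwinnertonDyer.Rank1Residual.ManinAdditive.TowerExtension
open Matrix
open scoped MatrixGroups

section Main

variable {N q p s : ℕ} {g : ℕ → ℤ → ZMod p}

/-- The induction step (5.4): class-independence at level `e` ⟹ at level `e + 1`. -/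
theorem tv_classIndep_succ (hq : q.Prime) (hqN : Nat.Coprime q N) (hs : 1 ≤ s)
    (level0 : ∀ r, g 0 r = 0)
    (period : ∀ n r, g n (r + (q : ℤ) ^ n) = g n r)
    (unreduce : ∀ n r, g (n + 1) ((q : ℤ) * r) = g n r)
    (even : ∀ n r, g n (-r) = g n r)
    (hMH : MultiHubRigid q p)
    (hres : ∀ (n : ℕ) (r t : ℤ), s ≤ n → IsCoprime r (q : ℤ) → g n (r + t * (q : ℤ) ^ s) = g n r)
    (hMHint : ∀ (γ : SL(2, ℤ)) (k e L : ℕ), 0 < k → Nat.Coprime k q → 1 ≤ e → e + Nat.totient (N * k) * s ≤ L →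
      ∀ ρ : ℤ, ((N * k : ℕ) : ℤ) * ρ ≡ 1 [ZMOD (q : ℤ) ^ L] →
      (γ : Matrix (Fin 2) (Fin 2) ℤ) 1 0 = ((N * q ^ e * k : ℕ) : ℤ) →
      (γ : Matrix (Fin 2) (Fin 2) ℤ) 1 1 ≡ 1 [ZMOD ((N * k : ℕ) : ℤ)] →
      ∀ x y : ℤ, ((N * k : ℕ) : ℤ) * x = 1 - (γ : Matrix (Fin 2) (Fin 2) ℤ) 1 1 →
        ((N * k : ℕ) : ℤ) * y = (γ : Matrix (Fin 2) (Fin 2) ℤ) 0 0 - 1 →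
        g e ρ - g e ((γ : Matrix (Fin 2) (Fin 2) ℤ) 1 1 * ρ) = g e y - g e x)
    (e : ℕ) (hIH : ∀ r r' : ℤ, IsCoprime r (q : ℤ) → IsCoprime r' (q : ℤ) → g e r = g e r') :
    ∀ r r' : ℤ, IsCoprime r (q : ℤ) → IsCoprime r' (q : ℤ) → g (e + 1) r = g (e + 1) r' := by
  haveI : Fact q.Prime := ⟨hq⟩
  have hkey := fun h h' hh hd hnd ↦ tv_key hq hqN hs level0 period unreduce hres hMHint e hIH (h := h) (h' := h') hh hd hnd
  have hmodq := fun h h' hh hd ↦ tv_modq (g := g) (e := e) hq hkey (h := h) (h' := h') hh hd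
  -- casting facts
  have hcop_val : ∀ x : ZMod q, x ≠ 0 → IsCoprime ((x.val : ℕ) : ℤ) (q : ℤ) := by
    intro x hx
    rw [isCoprime_iff_not_dvd_of_prime hq]
    intro hd
    have h1 : (((x.val : ℕ) : ℤ) : ZMod q) = 0 := (ZMod.intCast_zmod_eq_zero_iff_dvd _ q).mpr hd
    rw [Int.cast_natCast, ZMod.natCast_zmod_val] at h1
    exact hx h1
  have hcast_ne : ∀ r : ℤ, IsCoprime r (q : ℤ) → (r : ZMod q) ≠ 0 := by
    intro r hr h0
    exact (isCoprime_iff_not_dvd_of_prime hq r).mp hr ((ZMod.intCast_zmod_eq_zero_iff_dvd r q).mp h0)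
  -- `Ḡ`
  set G : ZMod q → ZMod p := fun x ↦ g (e + 1) ((x.val : ℕ) : ℤ) with hG
  have hrepr : ∀ r : ℤ, IsCoprime r (q : ℤ) → g (e + 1) r = G (r : ZMod q) := by
    intro r hr
    simp only [hG]
    refine (hmodq r _ hr ?_).symm
    rw [← ZMod.intCast_eq_intCast_iff_dvd_sub]
    rw [Int.cast_natCast, ZMod.natCast_zmod_val]
  have hrepr' : ∀ (r : ℤ) (x : ZMod q), IsCoprime r (q : ℤ) → (r : ZMod q) = x → g (e + 1) r = G x := by
    intro r x hr hx; rw [hrepr r hr, hx]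
  have heven : ∀ x : ZMod q, G (-x) = G x := by
    intro x
    by_cases hx : x = 0
    · rw [hx, neg_zero]
    · have hx' : -x ≠ 0 := neg_ne_zero.mpr hx
      have h1 := hcop_val (-x) hx'
      show g (e + 1) (((-x).val : ℕ) : ℤ) = g (e + 1) ((x.val : ℕ) : ℤ)
      rw [← even, hrepr' _ x h1.neg_left (by push_cast; rw [ZMod.natCast_zmod_val, neg_neg])]
  have hstar : ∀ hh D : ZMod q, hh ≠ 0 → D ≠ 0 → D ≠ 1 →
      G hh - G (hh * D) - G (hh * (1 - D) * D⁻¹) + G (hh * (1 - D)) = 0 := by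
    intro hh D hh0 hD0 hD1
    have hhc := hcop_val hh hh0
    have hm : 1 ≤ min (e + 1) s := le_min (by omega) hs
    obtain ⟨k, ρ, hk0, hkq, hρL, hρQ, hρh⟩ := tv_exists_hub (s := s) hq hqN (e + 1) hm hhc
    have hq1 : (q : ℤ) ∣ (q : ℤ) ^ (min (e + 1) s) := dvd_pow_self _ (by omega)
    have hρq : (ρ : ZMod q) = hh := by
      have h1 : (q : ℤ) ∣ ((hh.val : ℕ) : ℤ) - ρ := Int.modEq_iff_dvd.mp (Int.ModEq.of_dvd hq1 hρh)
      have h2 := (ZMod.intCast_eq_intCast_iff_dvd_sub ρ ((hh.val : ℕ) : ℤ) q).mpr h1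
      rw [h2, Int.cast_natCast, ZMod.natCast_zmod_val]
    have hρc : IsCoprime ρ (q : ℤ) := by
      rw [isCoprime_iff_not_dvd_of_prime hq]; intro hd
      exact hh0 (by rw [← hρq]; exact (ZMod.intCast_zmod_eq_zero_iff_dvd ρ q).mpr hd)
    have hNkρ : (N : ZMod q) * (k : ZMod q) * (ρ : ZMod q) = 1 := by
      have h1 : (q : ℤ) ∣ 1 - ((N * k : ℕ) : ℤ) * ρ := Int.modEq_iff_dvd.mp (Int.ModEq.of_dvd hq1 hρQ)
      have h2 := (ZMod.intCast_eq_intCast_iff_dvd_sub (((N * k : ℕ) : ℤ) * ρ) 1 q).mpr h1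
      rw [Int.cast_one] at h2
      push_cast at h2
      exact h2
    -- the deep row with `z = (d − 1) ρ`, `d = D.val`
    set d : ℤ := ((D.val : ℕ) : ℤ) with hd
    have hdD : (d : ZMod q) = D := by rw [hd, Int.cast_natCast, ZMod.natCast_zmod_val]
    set z : ℤ := (d - 1) * ρ with hz
    have hDcast : ((1 + ((N * k : ℕ) : ℤ) * z : ℤ) : ZMod q) = D := by
      rw [hz, show 1 + ((N * k : ℕ) : ℤ) * ((d - 1) * ρ) = 1 + (d - 1) * (((N * k : ℕ) : ℤ) * ρ) by ring]
      push_cast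
      rw [hNkρ, hdD]
      ring
    have hDq : IsCoprime (1 + ((N * k : ℕ) : ℤ) * z) (q : ℤ) := by
      rw [isCoprime_iff_not_dvd_of_prime hq]; intro hdv
      exact hD0 (by rw [← hDcast]; exact (ZMod.intCast_zmod_eq_zero_iff_dvd _ q).mpr hdv)
    obtain ⟨A, B, hdet, hEQ⟩ := tv_deepRow (s := s) hMHint hk0 hkq (by omega : 1 ≤ e + 1) hDq hρL
    -- `A ≡ D⁻¹`
    have hAD : (A : ZMod q) * D = 1 := by
      have h1 := congrArg (Int.cast : ℤ → ZMod q) hdet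
      push_cast at h1
      rw [show (((N : ℕ) : ZMod q)) * (q : ZMod q) ^ (e + 1) * (k : ZMod q) = 0 by
        rw [ZMod.natCast_self, zero_pow (by omega), mul_zero, zero_mul], mul_zero, sub_zero] at h1
      rw [← hDcast]; push_cast; exact h1
    have hAinv : (A : ZMod q) = D⁻¹ := eq_inv_of_mul_eq_one_left hAD
    have hAc : IsCoprime A (q : ℤ) := by
      rw [isCoprime_iff_not_dvd_of_prime hq]; intro hdv
      have : (A : ZMod q) = 0 := (ZMod.intCast_zmod_eq_zero_iff_dvd A q).mpr hdv
      rw [this, zero_mul] at hAD; exact zero_ne_one hAD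
    have hd1 : IsCoprime (d - 1) (q : ℤ) := by
      rw [isCoprime_iff_not_dvd_of_prime hq]; intro hdv
      have : ((d - 1 : ℤ) : ZMod q) = 0 := (ZMod.intCast_zmod_eq_zero_iff_dvd _ q).mpr hdv
      push_cast at this; rw [hdD, sub_eq_zero] at this; exact hD1 this
    have hzc : IsCoprime z (q : ℤ) := hd1.mul_left hρc
    -- translate the four terms
    have t1 : g (e + 1) ρ = G hh := hrepr' ρ hh hρc hρq
    have t2 : g (e + 1) ((1 + ((N * k : ℕ) : ℤ) * z) * ρ) = G (hh * D) :=
      hrepr' _ _ (hDq.mul_left hρc) (by rw [Int.cast_mul, hDcast, hρq, mul_comm])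
    have t3 : g (e + 1) (-z) = G (hh * (1 - D)) :=
      hrepr' _ _ hzc.neg_left (by rw [hz]; push_cast; rw [hρq, hdD]; ring)
    have t4 : g (e + 1) (-A * z + B * (q : ℤ) ^ (e + 1)) = G (hh * (1 - D) * D⁻¹) := by
      refine hrepr' _ _ ?_ ?_
      · rw [isCoprime_iff_not_dvd_of_prime hq]; intro hdv
        have h1 : (q : ℤ) ∣ B * (q : ℤ) ^ (e + 1) := ⟨B * (q : ℤ) ^ e, by ring⟩
        have h2 : (q : ℤ) ∣ A * z := by
          have := dvd_sub hdv h1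
          rw [show -A * z + B * (q : ℤ) ^ (e + 1) - B * (q : ℤ) ^ (e + 1) = -(A * z) by ring] at this
          exact dvd_neg.mp this
        rcases (Nat.prime_iff_prime_int.mp hq).dvd_or_dvd h2 with h3 | h3
        · exact (isCoprime_iff_not_dvd_of_prime hq A).mp hAc h3
        · exact (isCoprime_iff_not_dvd_of_prime hq z).mp hzc h3
      · rw [hz]; push_cast
        rw [ZMod.natCast_self, zero_pow (by omega), mul_zero, add_zero, hρq, hdD, hAinv]
        ring
    rw [t1, t2, t3, t4] at hEQ
    linear_combination hEQ
  -- LEMMA MH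
  have hconst := hMH G heven hstar
  intro r r' hr hr'
  rw [hrepr r hr, hrepr r' hr']
  exact hconst _ _ (hcast_ne r hr) (hcast_ne r' hr')

/-- **(5.4) CLASS-INDEPENDENCE** (an's `stub_classIndep`, explicit binders; LEMMA MH BY NAME): under (P0) (P1) (P2) (EV), the resolution `hres`
and the integer multi-hub equation `hMHint` (an's `fine_multiHub`), every level of the pattern is constant on the integers prime to `q`. -/
theorem tv_classIndep (hq : q.Prime) (hqN : Nat.Coprime q N) (hs : 1 ≤ s)
    (level0 : ∀ r, g 0 r = 0)
    (period : ∀ n r, g n (r + (q : ℤ) ^ n) = g n r)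
    (unreduce : ∀ n r, g (n + 1) ((q : ℤ) * r) = g n r)
    (even : ∀ n r, g n (-r) = g n r)
    (hMH : MultiHubRigid q p)
    (hres : ∀ (n : ℕ) (r t : ℤ), s ≤ n → IsCoprime r (q : ℤ) → g n (r + t * (q : ℤ) ^ s) = g n r)
    (hMHint : ∀ (γ : SL(2, ℤ)) (k e L : ℕ), 0 < k → Nat.Coprime k q → 1 ≤ e → e + Nat.totient (N * k) * s ≤ L →
      ∀ ρ : ℤ, ((N * k : ℕ) : ℤ) * ρ ≡ 1 [ZMOD (q : ℤ) ^ L] →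
      (γ : Matrix (Fin 2) (Fin 2) ℤ) 1 0 = ((N * q ^ e * k : ℕ) : ℤ) →
      (γ : Matrix (Fin 2) (Fin 2) ℤ) 1 1 ≡ 1 [ZMOD ((N * k : ℕ) : ℤ)] →
      ∀ x y : ℤ, ((N * k : ℕ) : ℤ) * x = 1 - (γ : Matrix (Fin 2) (Fin 2) ℤ) 1 1 →
        ((N * k : ℕ) : ℤ) * y = (γ : Matrix (Fin 2) (Fin 2) ℤ) 0 0 - 1 →
        g e ρ - g e ((γ : Matrix (Fin 2) (Fin 2) ℤ) 1 1 * ρ) = g e y - g e x) :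
    ∀ (e : ℕ) (r r' : ℤ), IsCoprime r (q : ℤ) → IsCoprime r' (q : ℤ) → g e r = g e r' := by
  intro e
  induction e with
  | zero => intro r r' _ _; rw [level0, level0]
  | succ e ih => exact tv_classIndep_succ hq hqN hs level0 period unreduce even hMH hres hMHint e ih

end Main

end Summit.BirchSwinnertonDyer.BirchSwinnertonDyer.Theorems.ManinLocalTwoThree
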